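import Summits.Ventures.CertifiedManyBodySolver.Downfold.RouterWordScoreSingletonTypings

/-!
# The RIDER CLASS of the §4.2 router-word score: a print led by an UNTYPED head is `PARTIAL` iff some typed
# primary rides, else `DISAGREE` — never a matter of which alternative «would have» matched
# (seat hubbard-downfold-score-2 gen 20; the M274 2H-MoTe₂ @20 class correction of 2026-08-30T00:15Z in kernel form)

Venture CertifiedManyBodySolver, cell `pub/hubbard-downfold`; namespace `Summit.Ventures.CertifiedManyBodySolver.Downfold.RouterScore`.
Everything here is PROVED (no `sorry`, standard axioms).

On 2026-08-30 a run seat handed in M274 2H-MoTe₂ @20 «UND:MIXED+EPH» against the typing «BI ∣ EPH ∣ EPH+UND:STRUCT» as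
«DISAGREE-informative»; score-2 corrected the class to `PARTIAL` before the stamp (ACCEPTANCE §4.2 clause 2: the typed
alternative «EPH»'s primary is among the emitted words) and the desk adopted it by erratum. The general fact behind the
correction is proved here once, over any head alphabet:

* §1 `outcome_untyped_head` — if the print's head `p` is non-structural and is the primary of NO typed alternative, the
  verdict is `PARTIAL` when some typed alternative's primary occurs in the print and `DISAGREE` otherwise (the `AGREE`
  branch is dead: a full match needs the heads to coincide). Corollaries `outcome_eq_partial_of_rider`,
  `outcome_eq_disagree_iff_no_typed_primary`.
* §2 on the router's heads: `eph_rider_partial` — on EVERY typing that lists the bare word «EPH», a print led by an untyped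
  non-structural head with «EPH» riding is `PARTIAL` (the M274 @20 / M220 TaS₂ / M231 YPd₂Sn shape); the M274 table by `decide`.

WHAT THIS IS NOT: not physics; not a verdict on any box; not the scorer of record — the kernel form of one clause of its letter.
-/

namespace Summit.Ventures.CertifiedManyBodySolver.Downfold

namespace RouterScore

/-! ## §1 Untyped head: the verdict is decided by the riders alone -/

section general

variable {α : Type*} [DecidableEq α] (structural : α → Bool)

/-- no alternative led by `p` ⇒ no alternative fully matches a print led by `p`. [folklore] -/
theorem any_fullMatch_eq_false_of_untyped {p : α} {tl : List α} {alts : List (List α)}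
    (huntyped : ∀ a ∈ alts, a.head? ≠ some p) : alts.any (fullMatch (p :: tl)) = false := by
  rw [List.any_eq_false]
  intro a ha hm
  simp only [fullMatch, List.head?_cons, Bool.and_eq_true, decide_eq_true_eq] at hm
  exact huntyped a ha hm.1

/-- UNTYPED HEAD IN CLOSED FORM. If the print's head is non-structural and leads no typed alternative, the score reads
only the riders: `PARTIAL` iff some typed alternative's primary occurs in the print, else `DISAGREE`. [folklore] -/
theorem outcome_untyped_head {p : α} (tl : List α) {alts : List (List α)} (halts : alts ≠ [])
    (hp : structural p = false) (huntyped : ∀ a ∈ alts, a.head? ≠ some p) :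
    outcome structural (p :: tl) alts =
      (if alts.any (primaryEmitted (p :: tl)) then .PARTIAL else .DISAGREE) := by
  rw [outcome_cons, if_neg halts, if_neg (by simp [hp]), any_fullMatch_eq_false_of_untyped huntyped]
  rfl

/-- … so a typed primary RIDING behind an untyped non-structural head makes the cell `PARTIAL`. [folklore] -/
theorem outcome_eq_partial_of_rider {p : α} {tl : List α} {alts : List (List α)} {a : List α} {q : α} {secs : List α}
    (ha : a ∈ alts) (haq : a = q :: secs) (hq : q ∈ tl)
    (hp : structural p = false) (huntyped : ∀ a ∈ alts, a.head? ≠ some p) :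
    outcome structural (p :: tl) alts = .PARTIAL := by
  have halts : alts ≠ [] := List.ne_nil_of_mem ha
  rw [outcome_untyped_head structural tl halts hp huntyped, if_pos]
  rw [List.any_eq_true]
  refine ⟨a, ha, ?_⟩
  subst haq
  rw [primaryEmitted_cons']
  simpa using Or.inr hq

/-- … and `DISAGREE` iff NO typed alternative's primary occurs anywhere in the print. [folklore] -/
theorem outcome_eq_disagree_iff_no_typed_primary {p : α} (tl : List α) {alts : List (List α)} (halts : alts ≠ [])
    (hp : structural p = false) (huntyped : ∀ a ∈ alts, a.head? ≠ some p) :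
    outcome structural (p :: tl) alts = .DISAGREE ↔ ∀ a ∈ alts, primaryEmitted (p :: tl) a = false := by
  rw [outcome_untyped_head structural tl halts hp huntyped]
  by_cases h : alts.any (primaryEmitted (p :: tl)) = true
  · rw [if_pos h]
    obtain ⟨a, ha, hpa⟩ := List.any_eq_true.1 h
    constructor
    · intro hc; exact absurd hc (by decide)
    · intro hall; rw [hall a ha] at hpa; exact absurd hpa (by decide)
  · rw [if_neg h]
    constructor
    · intro _ a ha
      cases hv : primaryEmitted (p :: tl) a with
      | false => rfl
      | true => exact absurd (List.any_eq_true.2 ⟨a, ha, hv⟩) h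
    · intro _; rfl

end general

open Head

/-! ## §2 On the router's heads: «EPH» riding behind an untyped head -/

/-- THE RIDER CLASS OF «EPH». On every typing that lists the bare word «EPH», a print led by a non-structural head that
leads no typed alternative, with «EPH» among its riders, is `PARTIAL` — whatever else the typing contains and whatever
else rides (the M274 2H-MoTe₂ @20 «UND:MIXED+EPH» vs «BI ∣ EPH ∣ EPH+UND:STRUCT» cell; the M220 / M221 TaS₂ / TaSe₂ and
M231–M233 Pd-Heusler straddles on «EPH» rows). [folklore] -/
theorem eph_rider_partial (p : Head) (tl : List Head) (alts : List (List Head)) (hmem : [eph] ∈ alts)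
    (hp : p.structural = false) (huntyped : ∀ a ∈ alts, a.head? ≠ some p) (heph : eph ∈ tl) :
    score (p :: tl) alts = .PARTIAL :=
  outcome_eq_partial_of_rider Head.structural hmem rfl heph hp huntyped

/-- M274 2H-MoTe₂ typing «BI ∣ EPH ∣ EPH+UND:STRUCT» (truth of record 2026-08-30). [folklore] -/
def mote2hTyping : List (List Head) := [[bi], [eph], [eph, undStruct]]

/-- The M274 cells by `decide`: @0 «BI» ⇒ AGREE (first alternative); @20 «UND:MIXED+EPH» ⇒ PARTIAL (EPH rides — the class
corrected before the stamp), NOT DISAGREE; a k-head with EPH riding ⇒ PARTIAL likewise; «EPH» / «EPH+UND:STRUCT» ⇒ AGREE;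
a straddle WITHOUT EPH ⇒ DISAGREE (what DISAGREE would have needed); a structure-led print ⇒ ABSTAIN(structure) (no typed
alternative is structure-led: «EPH+UND:STRUCT» is led by EPH). [folklore] -/
theorem mote2h_table :
    score [bi] mote2hTyping = .AGREE ∧
    score [undMixed, eph] mote2hTyping = .PARTIAL ∧
    score [undMultiorb, eph] mote2hTyping = .PARTIAL ∧
    score [eph] mote2hTyping = .AGREE ∧ score [eph, undStruct] mote2hTyping = .AGREE ∧
    score [undMixed] mote2hTyping = .DISAGREE ∧
    score [undStruct, undMixed, eph] mote2hTyping = .ABSTAIN_structure := by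
  decide

/-- The same cell through §2's general statement (not by enumeration): «UND:MIXED» is non-structural and leads no
alternative of the M274 typing, «EPH» is typed bare and rides ⇒ PARTIAL for ANY further riders `r`. [folklore] -/
theorem mote2h_straddle_partial (r : List Head) : score (undMixed :: (eph :: r)) mote2hTyping = .PARTIAL :=
  eph_rider_partial undMixed (eph :: r) mote2hTyping (by simp [mote2hTyping]) rfl
    (by intro a ha; simp only [mote2hTyping, List.mem_cons, List.not_mem_nil, or_false] at ha
        rcases ha with rfl | rfl | rfl <;> decide)
    List.mem_cons_self

end RouterScore

end Summit.Ventures.CertifiedManyBodySolver.Downfold
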